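import Summits.ResolutionOfSingularities.KangarooAtlas.MizutaniTriangular
import Summits.ResolutionOfSingularities.KangarooAtlas.MizutaniOdaEquality
import Summits.ResolutionOfSingularities.KangarooAtlas.MizutaniHironakaSide
import Mathlib.RingTheory.Nakayama
import HarnessLib

/-!
# `B_{P,𝔭}` is the cone over the point iff the point is cut out by linear forms (a `k`-rational linear point)

Cell `pub-rosobs`, Mizutani enclosure (seat mizutani-encloser-2, gen 5). AI-written; AI review is weaker than expert
review; NOT a resolution-of-singularities theorem (summit relevance C).

For every point `𝔭` of `ℙ^n_k` the Hironaka scheme CONTAINS the cone over the point: `U_+(𝔭)S ⊆ 𝔭` (`bIdeal_le` of the typing file,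
«`ℙ(B_{P,x'}) ∋ x'`»).  When is it EQUAL to it?  PROVED here:

* `isPrime_span_linForm` — an ideal of `k[X_0, …, X_n]` generated by LINEAR forms is prime (coordinate change of the tree's
  `coordChangeEquiv` to an ideal of variables);
* `span_linForm_hirForms_zero_le` — the ideal `(𝔭 ∩ S_1)·S` of the linear forms of `𝔭` (`= span (linForm '' (U(𝔭) ∩ L)_0)`) lies in
  `U_+(𝔭)S`;
* **`eq_span_linForm_of_bIdeal_eq`** — if `U_+(𝔭)S = 𝔭` then `𝔭 = (𝔭 ∩ S_1)·S`: by Hironaka's triangular basis `U_+(𝔭)S = (σ_1, …, σ_r)`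
  (`MizutaniTriangular.lean`), the generators of degree `p^{e_j} ≥ 2` lie in `𝔭^{(p^{e_j})} ⊆ 𝔭² S_𝔭`, so `𝔪 = (𝔭 ∩ S_1) S_𝔭 + 𝔪²` in `S_𝔭` and
  NAKAYAMA gives `𝔪 = (𝔭 ∩ S_1) S_𝔭`; de-localise along the prime `(𝔭 ∩ S_1)·S ⊆ 𝔭`;
* **`bIdeal_eq_self_iff`** — `U_+(𝔭)S = 𝔭 ↔ 𝔭 = (𝔭 ∩ S_1)·S`: **`B_{P,𝔭}` is the line/cone `V(𝔭)` over the point exactly for the points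
  cut out by linear forms over `k` (the `k`-rational linear points); for every other point `B_{P,𝔭} ⊋ V(𝔭)`;**
* `ringKrullDim_quotient_le_ringKrullDim_quotient_bIdeal`, `max_le_ringKrullDim_quotient_bIdeal_succ` — `dim B_{P,𝔭} ≥ dim V(𝔭)` and
  `dim B_{P,𝔭} + 1 ≥ max (dim V(𝔭) + 1, 2·p^{exponent})`.

## References

* H. Mizutani, *Hironaka's additive group schemes*, Nagoya Math. J. 52 (1973), Def. 1.1, §1 (c). [Mizutani1973HironakaGroupSchemes]
* V. Cossart, U. Jannsen, S. Saito, LNM 2270 (2020), proof of Thm. 3.14 p. 52 («ℙ(B_{P,x'}) contains x'»). [CossartJannsenSaito2020]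
-/

noncomputable section

open MvPolynomial Literature.AlgebraicGeometry.Resolution Literature.AlgebraicGeometry.Resolution.HironakaScheme
open Literature.AlgebraicGeometry.Hironaka2017.EdgeAlgebra Literature.RingTheory.MvPolynomial IsLocalRing

namespace Summit.ResolutionOfSingularities.KangarooAtlas.Mizutani

universe u

/-! ## Ideals generated by linear forms are prime -/

section Linear

variable {k : Type u} [Field k] {m : ℕ}

/-- **An ideal of `k[X_0, …, X_{m−1}]` generated by linear forms is prime** (after a linear change of coordinates it is an ideal of
variables, the kernel of killing them). [folklore] -/
theorem isPrime_span_linForm (N : Submodule k (Fin m → k)) :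
    (Ideal.span (linForm '' (N : Set (Fin m → k)))).IsPrime := by
  classical
  obtain ⟨b, J, J₂, hJ, _hJ₂⟩ := exists_basis_adapted N ⊥
  have hspan : Ideal.span (linForm '' (N : Set (Fin m → k))) =
      Ideal.span (linForm '' (b '' (↑J : Set (Fin m)))) := by
    rw [← hJ, ideal_span_image_span]
  set θ := coordChangeEquiv b with hθ
  have hmap : (Ideal.span (X '' (↑J : Set (Fin m))) : Ideal (MvPolynomial (Fin m) k)) =
      (Ideal.span (linForm '' (N : Set (Fin m → k)))).map
        (θ.toRingEquiv : MvPolynomial (Fin m) k →+* MvPolynomial (Fin m) k) := by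
    rw [hspan, Ideal.map_span]
    congr 1
    ext f
    constructor
    · rintro ⟨j, hj, rfl⟩
      refine ⟨linForm (b j), ⟨b j, ⟨j, hj, rfl⟩, rfl⟩, ?_⟩
      exact coordChangeEquiv_linForm_basis b j
    · rintro ⟨_, ⟨_, ⟨j, hj, rfl⟩, rfl⟩, rfl⟩
      exact ⟨j, hj, (coordChangeEquiv_linForm_basis b j).symm⟩
  have hprime : (Ideal.span (X '' (↑J : Set (Fin m))) : Ideal (MvPolynomial (Fin m) k)).IsPrime := by
    rw [← ker_killFin]
    exact RingHom.ker_isPrime _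
  have hback : Ideal.span (linForm '' (N : Set (Fin m → k))) =
      (Ideal.span (X '' (↑J : Set (Fin m))) : Ideal (MvPolynomial (Fin m) k)).map
        (θ.symm.toRingEquiv : MvPolynomial (Fin m) k →+* MvPolynomial (Fin m) k) := by
    rw [hmap, Ideal.map_map]
    have hcomp : (θ.symm.toRingEquiv : MvPolynomial (Fin m) k →+* MvPolynomial (Fin m) k).comp
        (θ.toRingEquiv : MvPolynomial (Fin m) k →+* MvPolynomial (Fin m) k) = RingHom.id _ := by
      ext f <;> simp
    rw [hcomp, Ideal.map_id]
  rw [hback]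
  exact Ideal.map_isPrime_of_equiv _

end Linear

/-! ## The linear forms of `𝔭` and `U_+(𝔭)S` -/

section Point

variable (k : Type u) [Field k] (p : ℕ) [hp : Fact p.Prime] [CharP k p] {n : ℕ}
  (𝔭 : Ideal (MvPolynomial (Fin (n + 1)) k))

/-- The coefficient vectors of the linear forms of `𝔭` are `(U(𝔭) ∩ L)_0`: `a ∈ hirForms 0 ↔ Σ a_j X_j ∈ 𝔭`.
[cite: Mizutani1973HironakaGroupSchemes, Def. 1.1 (U_1(p) = S_1 ∩ p)] -/
theorem mem_hirForms_zero_iff_linForm_mem [𝔭.IsPrime] (a : Fin (n + 1) → k) :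
    a ∈ hirForms k p 𝔭 0 ↔ linForm a ∈ 𝔭 := by
  rw [hirForms_eq_invForms, mem_invForms_zero_iff, addForm_zero_eq_linForm]

/-- `(𝔭 ∩ S_1)·S = span (linForm '' (U(𝔭) ∩ L)_0)`: the ideal of the linear forms of `𝔭`. [cite: Mizutani1973HironakaGroupSchemes, Def. 1.1] -/
theorem span_inter_one_eq_span_linForm [𝔭.IsPrime] :
    Ideal.span ((𝔭 : Set (MvPolynomial (Fin (n + 1)) k)) ∩ (homogeneousSubmodule (Fin (n + 1)) k 1 : Set (MvPolynomial (Fin (n + 1)) k))) =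
      Ideal.span (linForm '' (hirForms k p 𝔭 0 : Set (Fin (n + 1) → k))) := by
  congr 1
  ext f
  constructor
  · rintro ⟨hf𝔭, hf1⟩
    have hf1' : f ∈ LinearMap.range (linForm (K := k) (n := n + 1)) := by rw [range_linForm]; exact hf1
    obtain ⟨a, rfl⟩ := hf1'
    exact ⟨a, (mem_hirForms_zero_iff_linForm_mem k p 𝔭 a).mpr hf𝔭, rfl⟩
  · rintro ⟨a, ha, rfl⟩
    refine ⟨(mem_hirForms_zero_iff_linForm_mem k p 𝔭 a).mp ha, ?_⟩
    have h : linForm a ∈ LinearMap.range (linForm (K := k) (n := n + 1)) := ⟨a, rfl⟩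
    rw [range_linForm] at h
    exact h

/-- **`(𝔭 ∩ S_1)·S ⊆ U_+(𝔭)S`**: the linear forms of the point are equations of its Hironaka scheme (`B_{P,𝔭} ⊆` the linear span of the point).
[cite: Mizutani1973HironakaGroupSchemes, Def. 1.1] -/
theorem span_linForm_hirForms_zero_le [𝔭.IsPrime] (hP : IsPoint k 𝔭) :
    Ideal.span (linForm '' (hirForms k p 𝔭 0 : Set (Fin (n + 1) → k))) ≤ bIdeal k 𝔭 := by
  refine Ideal.span_le.mpr ?_
  rintro _ ⟨a, ha, rfl⟩
  rw [SetLike.mem_coe, ← addForm_zero_eq_linForm k p a]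
  exact (addForm_mem_bIdeal_iff k p 𝔭 hP).mpr ha

/-- The ideal of the linear forms of `𝔭` lies in `𝔭`. [folklore] -/
theorem span_linForm_hirForms_zero_le_self [𝔭.IsPrime] :
    Ideal.span (linForm '' (hirForms k p 𝔭 0 : Set (Fin (n + 1) → k))) ≤ 𝔭 :=
  Ideal.span_le.mpr (by rintro _ ⟨a, ha, rfl⟩; exact (mem_hirForms_zero_iff_linForm_mem k p 𝔭 a).mp ha)

/-- **If `U_+(𝔭)S = 𝔭` then `𝔭` is generated by its linear forms** (triangular basis + Nakayama in `S_𝔭` + de-localisation along the prime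
`(𝔭 ∩ S_1)·S`). [cite: Mizutani1973HironakaGroupSchemes, Def. 1.1, §1 (c)] -/
theorem eq_span_linForm_of_bIdeal_eq [𝔭.IsPrime] (hP : IsPoint k 𝔭) (hb : bIdeal k 𝔭 = 𝔭) :
    𝔭 = Ideal.span (linForm '' (hirForms k p 𝔭 0 : Set (Fin (n + 1) → k))) := by
  classical
  haveI : ExpChar k p := ExpChar.prime hp.out
  obtain ⟨P⟩ := nonempty_triangularPresentation_multAlgebra k p 𝔭 hP
  set L : Ideal (MvPolynomial (Fin (n + 1)) k) := Ideal.span (linForm '' (hirForms k p 𝔭 0 : Set (Fin (n + 1) → k))) with hL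
  have hLle : L ≤ 𝔭 := span_linForm_hirForms_zero_le_self k p 𝔭
  refine le_antisymm ?_ hLle
  -- work in `R = S_𝔭`
  have hgen : 𝔭 = Ideal.span (Set.range P.gen) := hb.symm.trans (bIdeal_eq_span_range_gen k p 𝔭 P)
  -- every generator lies in `L` (degree 1) or in `𝔭^{(p^{e_j})} ⊆ 𝔪² S_𝔭`
  have hgens : ∀ j : Fin P.r, algebraMap (MvPolynomial (Fin (n + 1)) k) (Localization.AtPrime 𝔭) (P.gen j) ∈
      L.map (algebraMap (MvPolynomial (Fin (n + 1)) k) (Localization.AtPrime 𝔭)) ⊔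
        maximalIdeal (Localization.AtPrime 𝔭) • maximalIdeal (Localization.AtPrime 𝔭) := by
    intro j
    have hcj : P.coef j ∈ hirForms k p 𝔭 (P.expo j) := by
      have h := P.gen_mem j
      rw [gen_eq_addForm] at h
      exact (addForm_mem_multAlgebra_iff k p 𝔭).mp h
    by_cases hej : P.expo j = 0
    · refine Ideal.mem_sup_left (Ideal.mem_map_of_mem _ (Ideal.subset_span ⟨P.coef j, ?_, ?_⟩))
      · rw [← hej]; exact hcj
      · rw [gen_eq_addForm k p P j, hej, addForm_zero_eq_linForm]
    · refine Ideal.mem_sup_right ?_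
      have hm := (mem_hirForms_iff_algebraMap_mem 𝔭 p (P.expo j) (P.coef j)).mp hcj
      rw [← gen_eq_addForm k p P j] at hm
      have h2 : 2 ≤ p ^ P.expo j := le_trans hp.out.two_le (Nat.le_self_pow hej p)
      rw [Ideal.smul_eq_mul, ← sq]
      exact Ideal.pow_le_pow_right h2 hm
  have hmle : maximalIdeal (Localization.AtPrime 𝔭) ≤
      L.map (algebraMap (MvPolynomial (Fin (n + 1)) k) (Localization.AtPrime 𝔭)) ⊔
        maximalIdeal (Localization.AtPrime 𝔭) • maximalIdeal (Localization.AtPrime 𝔭) := by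
    have hmax : maximalIdeal (Localization.AtPrime 𝔭) =
        Ideal.span ((algebraMap (MvPolynomial (Fin (n + 1)) k) (Localization.AtPrime 𝔭)) '' Set.range P.gen) := by
      rw [← Localization.AtPrime.map_eq_maximalIdeal, ← Ideal.map_span, ← hgen]
    refine (le_of_eq hmax).trans (Ideal.span_le.mpr ?_)
    rintro _ ⟨_, ⟨j, rfl⟩, rfl⟩
    exact hgens j
  -- Nakayama
  haveI : IsNoetherianRing (Localization.AtPrime 𝔭) :=
    IsLocalization.isNoetherianRing 𝔭.primeCompl (Localization.AtPrime 𝔭) inferInstance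
  have hfg : (maximalIdeal (Localization.AtPrime 𝔭)).FG := IsNoetherian.noetherian _
  have hjac : maximalIdeal (Localization.AtPrime 𝔭) ≤ Ideal.jacobson ⊥ := by
    rw [jacobson_eq_maximalIdeal ⊥ bot_ne_top]
  have hnak := Submodule.le_of_le_smul_of_le_jacobson_bot hfg hjac hmle
  -- de-localise: `𝔭 ≤ comap (map L) = L`
  intro f hf
  have hfm : algebraMap (MvPolynomial (Fin (n + 1)) k) (Localization.AtPrime 𝔭) f ∈
      L.map (algebraMap (MvPolynomial (Fin (n + 1)) k) (Localization.AtPrime 𝔭)) := by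
    refine hnak ?_
    rw [← Localization.AtPrime.map_eq_maximalIdeal]
    exact Ideal.mem_map_of_mem _ hf
  have hLprime : L.IsPrime := isPrime_span_linForm (hirForms k p 𝔭 0)
  have hdisj : Disjoint (𝔭.primeCompl : Set (MvPolynomial (Fin (n + 1)) k)) L := by
    rw [Set.disjoint_left]
    intro x hx hxL
    exact hx (hLle hxL)
  have hunder := IsLocalization.under_map_of_isPrime_disjoint 𝔭.primeCompl (Localization.AtPrime 𝔭) hLprime hdisj
  rw [← hunder]
  exact hfm

include p hp in
/-- **`U_+(𝔭)S = 𝔭` iff `𝔭` is generated by its linear forms**: the Hironaka scheme `B_{P,𝔭}` is the cone `V(𝔭)` over the point exactly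
for the points cut out by linear forms over `k` (for all other points `B_{P,𝔭} ⊋ V(𝔭)`).
[cite: Mizutani1973HironakaGroupSchemes, Def. 1.1, §1 (c)] -/
theorem bIdeal_eq_self_iff [𝔭.IsPrime] (hP : IsPoint k 𝔭) :
    bIdeal k 𝔭 = 𝔭 ↔
      𝔭 = Ideal.span ((𝔭 : Set (MvPolynomial (Fin (n + 1)) k)) ∩
        (homogeneousSubmodule (Fin (n + 1)) k 1 : Set (MvPolynomial (Fin (n + 1)) k))) := by
  rw [span_inter_one_eq_span_linForm k p 𝔭]
  constructor
  · exact eq_span_linForm_of_bIdeal_eq k p 𝔭 hP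
  · intro h
    refine le_antisymm bIdeal_le ?_
    conv_lhs => rw [h]
    exact span_linForm_hirForms_zero_le k p 𝔭 hP

include p hp in
/-- In that case `B_{P,𝔭}` is a vector group (its ideal `𝔭` is generated by linear forms). [cite: Mizutani1973HironakaGroupSchemes, Rem. 1.2] -/
theorem isVectorGroup_of_bIdeal_eq_self [𝔭.IsPrime] (hP : IsPoint k 𝔭) (hb : bIdeal k 𝔭 = 𝔭) : IsVectorGroup k 𝔭 := by
  have h := (bIdeal_eq_self_iff k p 𝔭 hP).mp hb
  unfold IsVectorGroup
  rw [hb]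
  exact le_antisymm (le_of_eq h) (Ideal.span_le.mpr fun _ hf => hf.1)

/-- **`dim B_{P,𝔭} ≥ dim V(𝔭)`**: the Hironaka scheme contains the cone over the (closure of the) point, so
`ringKrullDim (S ⧸ 𝔭) ≤ ringKrullDim (S ⧸ U_+(𝔭)S)` — for every ideal `𝔭` (prime suffices for `bIdeal_le`).
[cite: CossartJannsenSaito2020, proof of Thm. 3.14 p. 52 («ℙ(B_{P,x'}) contains x'»)] -/
theorem ringKrullDim_quotient_le_ringKrullDim_quotient_bIdeal [𝔭.IsPrime] :
    ringKrullDim (MvPolynomial (Fin (n + 1)) k ⧸ 𝔭) ≤ ringKrullDim (MvPolynomial (Fin (n + 1)) k ⧸ bIdeal k 𝔭) :=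
  ringKrullDim_le_of_surjective (Ideal.Quotient.factor (bIdeal_le (𝔭 := 𝔭)))
    (Ideal.Quotient.factor_surjective (bIdeal_le (𝔭 := 𝔭)))

/-- Hence **`dim B_{P,𝔭} ≥ max (dim V(𝔭), 2·p^{exponent} − 1)`**, the second bound being Mizutani's (encloser-1 g4's
`mizutani_lowerBound_hironaka`). [cite: Mizutani1973HironakaGroupSchemes, Remark 2.10] -/
theorem max_le_ringKrullDim_quotient_bIdeal_succ [𝔭.IsPrime] (hP : IsPoint k 𝔭) :
    max (ringKrullDim (MvPolynomial (Fin (n + 1)) k ⧸ 𝔭) + 1) (2 * p ^ exponent k p 𝔭 : WithBot ℕ∞) ≤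
      ringKrullDim (MvPolynomial (Fin (n + 1)) k ⧸ bIdeal k 𝔭) + 1 :=
  max_le (add_le_add_left (ringKrullDim_quotient_le_ringKrullDim_quotient_bIdeal k 𝔭) 1)
    (mizutani_lowerBound_hironaka k p 𝔭 hP)

end Point

end Summit.ResolutionOfSingularities.KangarooAtlas.Mizutani

end
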